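import Literature.Probability.RandomPlanarGeometry.SAWWidePolygons
import Literature.Probability.RandomPlanarGeometry.SAWCount
import HarnessLib

/-!
# Duminil-Copin–Ganguly–Hammond–Manolescu 2020: Hammersley–Welsh with polygon insertion
# (Proposition 4.1(2): wide-polygon abundance at scale `n^δ` bounds `|SAW_ℓ|` on `⟦n^{3/2}, n²⟧`)

Topic `Literature/Probability/RandomPlanarGeometry` (continues `SAWWidePolygons.lean`: the finset
`widePolygons u m = WSAP^u_m` of `m`-edge self-avoiding polygons of `ℤ²` up to translation with
line-width `≥ u` and height `≤ 16u`; `BDGS2012.lean` / `SAWCount.lean`: `Zd.count 2 ℓ = c_ℓ = |SAW_ℓ|`,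
`Zd.connectiveConstant 2 = μ`).

Source, read in the arXiv version (locators `pNNNN:Lk` = chunk : line of the held text
`paper:arxiv-1809.00760`): H. Duminil-Copin, S. Ganguly, A. Hammond, I. Manolescu, *Bounding the
number of self-avoiding walks: Hammersley–Welsh with polygon insertion*, Ann. Probab. **48** (2020)
1644–1692, arXiv:1809.00760, §4 "Hammersley-Welsh with polygon insertion: reducing to a key estimate".

* (4.1)–(4.2) (p0015:L19–24): "Of these five positive parameters, the first three are exponents on
  which we impose the conditions that `2ε ≤ δ < 1/2 − ε` and `ε + αδ < 1/2`."
* **Proposition 4.1** (p0015:L39–65), verbatim: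
  "(1) Fix a triple `(ε,δ,α)` of positive exponents satisfying (4.1) and (4.2). There exists a constant
  `C = C(ε) > 0` such that, whenever `n ∈ ℕ` satisfies the condition
  (4.3) there exist `u ∈ [n^δ, 2n^δ]` and `m ≤ 4⁻¹u²`, for which `|WSAP^u_m| ≥ n^{−αδ} μ^m`,
  we have that `|HSW_n| ≤ C exp(21 n^{1/2−ε} log n) · μ^n`.
  (2) Fix a triplet `(ε,δ,α)` of positive exponents satisfying the stronger conditions
  (4.6) `4ε ≤ δ < 1/2 − ε` and `ε + 2αδ < 1/2`.
  Then there exists a constant `C = C(ε) > 0` such that, whenever `n ∈ ℕ` satisfies (4.3), any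
  `ℓ ∈ ⟦n^{3/2}, n²⟧` satisfies `|SAW_ℓ| ≤ exp(C ℓ^{1/2−ε} log ℓ) · μ^ℓ`."
  (`⟦a,b⟧ := [a,b] ∩ ℤ`, §1.2 p0004:L25; `μ = lim c_n^{1/n}` on `ℤ²`; `WSAP^u_m` for `m ∈ 2ℕ`, `u ∈ ℕ`,
  §3.1 p0010:L24–28.)

## What is vendored

* `DGHM2020.Cond43 c₀ δ α n` — condition (4.3) at length `n`, over the tree's `widePolygons`, with the
  LENGTH CAP `m ≤ c₀u²` written as a parameter `c₀` (AS PRINTED `c₀ = 4⁻¹`).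
* `DGHM2020.Admissible46 ε δ α` — "positive exponents satisfying (4.6)".
* `DGHM2020.Prop41Part2 c₀` — the sentence of Proposition 4.1(2) read with cap `c₀` in (4.3) (a
  definition SCHEMA; only its printed instance is asserted).
* **`DGHM2020_prop41_2`** — the NAMED FACT: Proposition 4.1(2) exactly as printed (`c₀ = 4⁻¹`), written
  out in full; `DGHM2020_prop41_2_iff : DGHM2020_prop41_2 ↔ DGHM2020.Prop41Part2 4⁻¹` is `Iff.rfl`.

Proved API: `Cond43.mono` (monotone in the cap), `Prop41Part2.anti` (ANTItone in the cap — the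
printed `c₀ = 4⁻¹` sentence is the weakest of the family), `widePolygons_eq_empty_of_lt_three`,
`not_cond43_one` (for `c₀ < 3/4` condition (4.3) fails at `n = 1`, so the printed quantifier
"whenever `n ∈ ℕ`" meets the one window, `⟦1,1⟧`, on which the conclusion would be false —
`c₁ = 4 > μ` — only vacuously; at `n = 0` the window is `{0}` and `c₀ = 1 = exp(0)μ⁰`).

## Reading note (recorded, not repaired): the length window of (4.3) vs. Proposition 3.1

AS PRINTED, (4.3) (p0015:L44) accepts polygon lengths `m ≤ 4⁻¹u²` only, while the paper's own
abundance input on `ℤ²`, Proposition 3.1 (p0010:L55–61: "for all `u ∈ A` there exists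
`m ∈ ⟦4u+4, 4u²+4⟧` for which `|WSAP^u_m| ≥ u^{−α}μ^m`", obtained through Lemma 3.3, p0010:L78–84,
at length `4m+4` and width `u ∈ [m^{1/2}, m]`), delivers lengths up to `4u²+4`, and the proof of
Theorem 1.2 (p0015:L77–p0016:L9: "Proposition 3.1 ensures that there are infinitely many values of
`(u,m)` satisfying `|WSAP^u_m| ≥ u^{−α}μ^m`. For any such value of `u`, choose `n` such that
`u/2 ≤ n^δ ≤ u`. Then Proposition 4.1(2) implies …") plugs one into the other without reconciling the
two windows. The `4⁻¹` is a bookkeeping constant of the proof of Proposition 4.1 (§2.3, p0008: the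
inserted polygons have length "`m` at most `n^{2δ}`"; the hexagonal twin, Proposition 3.2, p0010:L65–70,
is stated with "`m ≤ c₀u²`"), which is why the cap is exposed here as the parameter `c₀`: a consumer
holding abundance at cap `c₀ > 4⁻¹` needs `Prop41Part2 c₀`, which the printed sentence
(`= Prop41Part2 4⁻¹`, the weakest instance, `Prop41Part2.anti`) does not supply. Only the printed
instance is a Literature fact; `Prop41Part2 c₀` for other `c₀` is a hypothesis schema, and every use of
it with `c₀ ≠ 4⁻¹` is to be labelled a **repaired reading (cap)** of Proposition 4.1(2) — not a cited
theorem (lane pcv-sawmu, referee finding §6, 2026-08-21; lead ruling (a), 2026-08-22). Part (1) of the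
proposition (half-space walks `HSW_n`) is quoted above and not vendored (no consumer).

## References

* H. Duminil-Copin, S. Ganguly, A. Hammond, I. Manolescu, Ann. Probab. 48 (2020) 1644–1692,
  doi:10.1214/19-aop1400, arXiv:1809.00760 — Prop. 4.1, eqs. (4.1)–(4.3), (4.6); Prop. 3.1, Lemma 3.3,
  proof of Thm 1.2. [DuminilCopinGangulyHammondManolescu2020]
-/

noncomputable section

open Literature.Probability.LatticeModels Literature.Probability.Percolation

namespace Literature.Probability.RandomPlanarGeometry.SAW

namespace DGHM2020

/-- Condition **(4.3)** of DGHM20 Proposition 4.1 at length `n`, for exponents `δ, α`, with the length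
cap as a parameter `c₀`: "there exist `u ∈ [n^δ, 2n^δ]` and `m ≤ 4⁻¹u²`, for which
`|WSAP^u_m| ≥ n^{−αδ} μ^m`" is the case `c₀ = 4⁻¹` (AS PRINTED). Here `u, m ∈ ℕ` as in the definition of
`WSAP^u_m` (§3.1, p0010:L24: "Let `m ∈ 2ℕ` and `u ∈ ℕ`"; for odd `m` the set `widePolygons u m` is empty,
so the parity is automatic), `|WSAP^u_m| = (widePolygons u m).card`, `μ = Zd.connectiveConstant 2`.
[cite: DuminilCopinGangulyHammondManolescu2020, Prop. 4.1, eq. (4.3) (p0015:L41–45)] -/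
def Cond43 (c₀ δ α : ℝ) (n : ℕ) : Prop :=
  ∃ u m : ℕ, (n : ℝ) ^ δ ≤ u ∧ (u : ℝ) ≤ 2 * (n : ℝ) ^ δ ∧ (m : ℝ) ≤ c₀ * (u : ℝ) ^ 2 ∧
    (n : ℝ) ^ (-(α * δ)) * Zd.connectiveConstant 2 ^ m ≤ ((widePolygons u m).card : ℝ)

/-- The exponent conditions **(4.6)** of DGHM20 Proposition 4.1(2) for "a triplet `(ε,δ,α)` of positive
exponents satisfying the stronger conditions `4ε ≤ δ < 1/2 − ε` and `ε + 2αδ < 1/2`".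
[cite: DuminilCopinGangulyHammondManolescu2020, Prop. 4.1(2), eq. (4.6) (p0015:L54–58)] -/
def Admissible46 (ε δ α : ℝ) : Prop :=
  0 < ε ∧ 0 < δ ∧ 0 < α ∧ 4 * ε ≤ δ ∧ δ < 1 / 2 - ε ∧ ε + 2 * α * δ < 1 / 2

/-- The sentence of **DGHM20 Proposition 4.1(2)** read with length cap `c₀` in condition (4.3)
(a definition schema; the printed instance `c₀ = 4⁻¹` is the named fact `DGHM2020_prop41_2`, other
instances are NOT asserted — a hypothesis `Prop41Part2 c₀` with `c₀ ≠ 4⁻¹` is a "repaired reading (cap)"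
of the proposition, never the cited theorem): "Fix a triplet `(ε,δ,α)` of positive exponents satisfying the stronger
conditions (4.6). Then there exists a constant `C = C(ε) > 0` such that, whenever `n ∈ ℕ` satisfies
(4.3), any `ℓ ∈ ⟦n^{3/2}, n²⟧` satisfies `|SAW_ℓ| ≤ exp(C ℓ^{1/2−ε} log ℓ) · μ^ℓ`."
(`|SAW_ℓ| = Zd.count 2 ℓ`, `μ = Zd.connectiveConstant 2`.)
[cite: DuminilCopinGangulyHammondManolescu2020, Prop. 4.1(2) (p0015:L53–65)] -/
def Prop41Part2 (c₀ : ℝ) : Prop :=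
  ∀ ε δ α : ℝ, Admissible46 ε δ α → ∃ C : ℝ, 0 < C ∧ ∀ n : ℕ, Cond43 c₀ δ α n →
    ∀ ℓ : ℕ, (n : ℝ) ^ (3 / 2 : ℝ) ≤ ℓ → ℓ ≤ n ^ 2 →
      (Zd.count 2 ℓ : ℝ) ≤
        Real.exp (C * (ℓ : ℝ) ^ (1 / 2 - ε) * Real.log ℓ) * Zd.connectiveConstant 2 ^ ℓ

/-- Condition (4.3) is monotone in the length cap: a witness `(u, m)` with `m ≤ c₀u²` is one with
`m ≤ c₀'u²` for `c₀ ≤ c₀'`. [cite: DuminilCopinGangulyHammondManolescu2020, eq. (4.3)] -/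
theorem Cond43.mono {c₀ c₀' δ α : ℝ} (hc : c₀ ≤ c₀') {n : ℕ} (h : Cond43 c₀ δ α n) :
    Cond43 c₀' δ α n := by
  obtain ⟨u, m, h1, h2, hm, hW⟩ := h
  exact ⟨u, m, h1, h2, hm.trans (mul_le_mul_of_nonneg_right hc (sq_nonneg _)), hW⟩

/-- Proposition 4.1(2) is ANTItone in the length cap: the reading that accepts witnesses up to `c₀'u²`
implies the one accepting them only up to `c₀u²`, `c₀ ≤ c₀'`; the printed `c₀ = 4⁻¹` sentence is thus
the weakest member of the family `{Prop41Part2 c₀ : c₀ ≥ 4⁻¹}`.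
[cite: DuminilCopinGangulyHammondManolescu2020, Prop. 4.1(2)] -/
theorem Prop41Part2.anti {c₀ c₀' : ℝ} (hc : c₀ ≤ c₀') (h : Prop41Part2 c₀') : Prop41Part2 c₀ := by
  intro ε δ α hadm
  obtain ⟨C, hC, hn⟩ := h ε δ α hadm
  exact ⟨C, hC, fun n h43 => hn n (h43.mono hc)⟩

/-- A self-avoiding polygon has at least three edges, so `WSAP^u_m = ∅` for `m < 3`.
[cite: DuminilCopinGangulyHammondManolescu2020, §3.1 (WSAP ⊆ SAP_m)] -/
theorem widePolygons_eq_empty_of_lt_three {u m : ℕ} (hm : m < 3) : widePolygons u m = ∅ := by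
  classical
  refine Finset.eq_empty_of_forall_notMem fun E hE => ?_
  obtain ⟨hP, hcard, -, -, -⟩ := mem_widePolygons.1 hE
  obtain ⟨v, c, hc, hlen⟩ := hP.exists_length_eq
  have h3 := hc.three_le_length
  omega

/-- Sanity of the printed quantifier "whenever `n ∈ ℕ`": for a cap `c₀ < 3/4` (in particular the
printed `4⁻¹`) condition (4.3) FAILS at `n = 1` — there `u ∈ {1, 2}`, so `m ≤ c₀u² < 3` and
`WSAP^u_m = ∅`, while `n^{−αδ}μ^m = μ^m > 0`. (At `n = 1` the window `⟦n^{3/2}, n²⟧ = {1}` carries the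
false inequality `c₁ = 4 ≤ μ`; it is never reached.)
[cite: DuminilCopinGangulyHammondManolescu2020, Prop. 4.1, eq. (4.3)] -/
theorem not_cond43_one {c₀ δ α : ℝ} (hc : c₀ < 3 / 4) : ¬ Cond43 c₀ δ α 1 := by
  rintro ⟨u, m, h1, h2, hm, hW⟩
  simp only [Nat.cast_one, Real.one_rpow, mul_one, one_mul] at h1 h2 hW
  -- `1 ≤ u ≤ 2`, hence `c₀u² < (3/4)·4 = 3` and `m < 3`
  have hu2 : (u : ℝ) ^ 2 ≤ 4 := by nlinarith
  have hu0 : (0 : ℝ) < u := by linarith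
  have hpos : (0 : ℝ) < (3 / 4 - c₀) * (u : ℝ) ^ 2 := mul_pos (by linarith) (pow_pos hu0 2)
  have hm3 : (m : ℝ) < 3 := by nlinarith [hpos, hu2, hm]
  have hm3' : m < 3 := by exact_mod_cast hm3
  rw [widePolygons_eq_empty_of_lt_three hm3', Finset.card_empty, Nat.cast_zero] at hW
  exact absurd hW (not_le.2 (pow_pos (Zd.connectiveConstant_pos 2) m))

end DGHM2020

/-- **Duminil-Copin–Ganguly–Hammond–Manolescu 2020, Proposition 4.1(2)** (Hammersley–Welsh with polygon
insertion on `ℤ²`), AS PRINTED: "Fix a triplet `(ε,δ,α)` of positive exponents satisfying the stronger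
conditions (4.6) `4ε ≤ δ < 1/2 − ε` and `ε + 2αδ < 1/2`. Then there exists a constant `C = C(ε) > 0`
such that, whenever `n ∈ ℕ` satisfies (4.3) [there exist `u ∈ [n^δ, 2n^δ]` and `m ≤ 4⁻¹u²`, for which
`|WSAP^u_m| ≥ n^{−αδ} μ^m`], any `ℓ ∈ ⟦n^{3/2}, n²⟧` satisfies
`|SAW_ℓ| ≤ exp(C ℓ^{1/2−ε} log ℓ) · μ^ℓ`." In the tree's vocabulary: `|SAW_ℓ| = Zd.count 2 ℓ`,
`μ = Zd.connectiveConstant 2`, `|WSAP^u_m| = (widePolygons u m).card` (`u, m ∈ ℕ`). This is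
`DGHM2020.Prop41Part2 4⁻¹` written out (`DGHM2020_prop41_2_iff`); see the module docstring for the
reading note on the length window `4⁻¹u²` of (4.3) versus the paper's Proposition 3.1.
[cite: DuminilCopinGangulyHammondManolescu2020, Prop. 4.1(2) with eqs. (4.3), (4.6) (arXiv p0015:L39–65)] -/
def DGHM2020_prop41_2 : Prop :=
  ∀ ε δ α : ℝ, 0 < ε → 0 < δ → 0 < α → 4 * ε ≤ δ → δ < 1 / 2 - ε → ε + 2 * α * δ < 1 / 2 →
    ∃ C : ℝ, 0 < C ∧ ∀ n : ℕ,
      (∃ u m : ℕ, (n : ℝ) ^ δ ≤ u ∧ (u : ℝ) ≤ 2 * (n : ℝ) ^ δ ∧ (m : ℝ) ≤ 4⁻¹ * (u : ℝ) ^ 2 ∧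
        (n : ℝ) ^ (-(α * δ)) * Zd.connectiveConstant 2 ^ m ≤ ((widePolygons u m).card : ℝ)) →
      ∀ ℓ : ℕ, (n : ℝ) ^ (3 / 2 : ℝ) ≤ ℓ → ℓ ≤ n ^ 2 →
        (Zd.count 2 ℓ : ℝ) ≤
          Real.exp (C * (ℓ : ℝ) ^ (1 / 2 - ε) * Real.log ℓ) * Zd.connectiveConstant 2 ^ ℓ

/-- The named fact is the printed instance `c₀ = 4⁻¹` of the schema `DGHM2020.Prop41Part2`.
[cite: DuminilCopinGangulyHammondManolescu2020, Prop. 4.1(2)] -/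
theorem DGHM2020_prop41_2_iff : DGHM2020_prop41_2 ↔ DGHM2020.Prop41Part2 4⁻¹ := by
  constructor
  · intro h ε δ α hadm
    obtain ⟨hε, hδ, hα, h4, hlt, h2⟩ := hadm
    exact h ε δ α hε hδ hα h4 hlt h2
  · intro h ε δ α hε hδ hα h4 hlt h2
    exact h ε δ α ⟨hε, hδ, hα, h4, hlt, h2⟩

/-- From the printed fact, every reading with a SMALLER cap `c₀ ≤ 4⁻¹` follows (`Prop41Part2.anti`);
readings with a larger cap do not. [cite: DuminilCopinGangulyHammondManolescu2020, Prop. 4.1(2)] -/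
theorem DGHM2020_prop41_2.of_cap_le (h : DGHM2020_prop41_2) {c₀ : ℝ} (hc : c₀ ≤ 4⁻¹) :
    DGHM2020.Prop41Part2 c₀ :=
  (DGHM2020_prop41_2_iff.1 h).anti hc

end Literature.Probability.RandomPlanarGeometry.SAW
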